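import Summits.BirchSwinnertonDyer.BirchSwinnertonDyer.Theorems.SignedLowerHalvesSmallImageLowerHalfBothSignsRttD2SeqJ3HS2Frame
import Summits.BirchSwinnertonDyer.BirchSwinnertonDyer.Theorems.SignedLowerHalvesSmallImageLowerHalfBothSignsRttD2SeqJ3RCofreeUnramified
import Summits.BirchSwinnertonDyer.BirchSwinnertonDyer.Theorems.SignedLowerHalvesSmallImageLowerHalfBothSignsRttD2SeqPlaceData
import Summits.BirchSwinnertonDyer.BirchSwinnertonDyer.Theorems.SignedLowerHalvesSmallImageLowerHalfBothSignsRttD2FrameRamification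
import Summits.BirchSwinnertonDyer.BirchSwinnertonDyer.Theorems.PrintCf2RubinValueTwoJLKDescentRowOneOfClass
import Literature.NumberTheory.ComplexMultiplication.EllipticUnits.ImaginaryQuadraticMainConjectureClassGroupRowExhaustion
import Literature.NumberTheory.GaloisRepresentations.HeckeCharacterProofs
import Literature.NumberTheory.EllipticCurves.LFunctionPrimeCoeff
import Literature.NumberTheory.EllipticCurves.GreenbergSelmerCharIdealPrincipalProofs
import Literature.NumberTheory.Automorphic.PadicIntermediateFieldUnitBall
import HarnessLib

/-!
# Route `SignedLowerHalves`, crux L `SmallImageLowerHalfBothSigns` (stmt-BirchSwinnertonDyer-23599), line `rtt_w3` v22/v23 — E2, row J3 = S2: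
# ★★★ S2 FRAME-PLUMBED — g24's `exists_lam_forall_exact_junctionMap_comp_subtype_cofree` RE-STATED ON THE SKELETON'S Γ-BINDERS

WIDTH seat `bsd-line-slh-p3-w3` g25 under LEAD `cruxlead-stmt-BirchSwinnertonDyer-23599` g13 (cell `bsd-ssimc`); helper `--supports stmt-BirchSwinnertonDyer-23599`.
THEOREMS ONLY (no definition, no named fact, no instance, no `sorry`). §1 discharges every entry of LEAD g12's FRAME-PLUMBING DICTIONARY as a NAMED lemma
in the stub's own vocabulary (`v := vp` with `hv : vp.asIdeal = (p)`, `P := suppPF p 𝔣`, `S₀K := {w | ∃ v ∈ S₀, ℓ_v ∈ w}`, `γB := γK⁻¹`, `κ_K := κ.restrictOfFinrankEqTwo hp K hK2`,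
frame = the `θ′·θ₀₀ = 1` conjunct of `CharRoadFrameProps` + the two conjuncts (R)/(U) of `CharRoadFrameSupp`, curve/character inputs `hθ` (unramified off `p𝔪`), `hbad`,
`hS₀bad`, `hS₀p`): `hpv` (`eq_of_natCast_mem_asIdeal_of_eq_span`), `hvP` (`mem_suppPF_of_eq_span`), `hvS₀` (`not_mem_placesAboveFinset_of_eq_span`), `hS₀` finite
(`finite_placesAboveFinset`), `hNP` (`ramificationSubgroup_suppPF_le_layerSubgroup`), `hγB` (`inv_mul_resGalOfEmb_mem_kerSubgroup`), `hθN` (`frame_eq_one_of_mem_ramificationSubgroup`),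
`hunrP`/`hMP` (`isUnramifiedAt_of_frameSupp`, `forall_smul_cofree_eq_of_frameSupp`), `hPS₀` (`eq_of_mem_suppPF_of_not_mem_placesAboveFinset`). §2 is ★★★
`exists_lam_forall_exact_junctionMap_comp_subtype_cofree_frame`: S2 of the v23 SPEC (item 5) — `∃ lam hlam, lam ≠ 0 ∧ ∀ local data, ∀ jv pinned, Function.Exact (jv ∘ₗ B′.subtype) gX`
— whose ONLY inputs are Γ's binders, so that the registered stub closes by one positional application. HONEST FRAMING: bookkeeping over g24's H7f/H7g; E2, crux L, crux M,
BSD remain OPEN and are proved for NO curve.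

References: [Kobayashi2003] Thm. 7.3 i); [Rubin2000] Thm. 1.7.3, §4.2; [NeukirchSchmidtWingberg2008] VIII §3, §6; [Washington1997] Prop. 13.2; [SerreAbelianLadic1968] I §2.1;
[SilvermanAEC2009] VII.5; [NeukirchANT1999] I §8.
-/

set_option autoImplicit false
set_option linter.dupNamespace false -- D-0017: single-problem summit, the namespace repeats the problem name by design
noncomputable section

open scoped Classical
open NumberField IsDedekindDomain Field Matrix CategoryTheory Function Rat.HeightOneSpectrum

namespace Summit.BirchSwinnertonDyer.BirchSwinnertonDyer.Theorems.SmallImageRttD2Seq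

open Literature.NumberTheory.EllipticCurves Literature.NumberTheory.EllipticCurves.GreenbergSelmer Literature.NumberTheory.GaloisRepresentations
  Literature.NumberTheory.GaloisRepresentations.DiscreteGaloisModule Literature.NumberTheory.GaloisCohomology
  Literature.NumberTheory.EllipticCurves.GreenbergVatsal2000 Literature.NumberTheory.ComplexMultiplication.EllipticUnits.JohnsonLeungKings2011
  Summit.BirchSwinnertonDyer.BirchSwinnertonDyer.Theorems.SmallImageCharSignedSelmer Summit.BirchSwinnertonDyer.BirchSwinnertonDyer.Theorems.SmallImageRttD2J1

/-! ## §1. The frame-plumbing dictionary, entry by entry -/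

section Plumbing

variable {K : Type} [Field K] [NumberField K] {p : ℕ} [Fact p.Prime]

omit [Fact p.Prime] in
/-- `hpv`: the place `vp = (p)` is the ONLY place of `K` containing `p` (a non-zero prime of a Dedekind domain is maximal). [cite: NeukirchANT1999, Ch. I §8 (8.2)–(8.3)] -/
theorem eq_of_natCast_mem_asIdeal_of_eq_span {vp : HeightOneSpectrum (𝓞 K)} (hv : vp.asIdeal = Ideal.span {((p : ℕ) : 𝓞 K)}) :
    ∀ w : HeightOneSpectrum (𝓞 K), ((p : ℕ) : 𝓞 K) ∈ w.asIdeal → w = vp := by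
  intro w hw
  have hle : vp.asIdeal ≤ w.asIdeal := by
    rw [hv]
    exact (Ideal.span_singleton_le_iff_mem _).mpr hw
  exact HeightOneSpectrum.ext ((vp.isPrime.isMaximal vp.ne_bot).eq_of_le w.isPrime.ne_top hle).symm

omit [Fact p.Prime] in
/-- `hvP`: `vp = (p) ∈ supp(p𝔣)`. [cite: JohnsonLeungKings2011, Cor. 5.3] -/
theorem mem_suppPF_of_eq_span (𝔣 : Ideal (𝓞 K)) {vp : HeightOneSpectrum (𝓞 K)} (hv : vp.asIdeal = Ideal.span {((p : ℕ) : 𝓞 K)}) :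
    vp ∈ suppPF p 𝔣 :=
  ClassGroupRow.mem_suppPF_of_mem p 𝔣 vp (natCast_mem_asIdeal_of_eq_span hv)

/-- A natural number lying in `w` is divisible by the rational prime below `w`. [cite: NeukirchANT1999, Ch. I §8 (8.2)–(8.3)] -/
theorem natGenerator_under_dvd_of_natCast_mem (w : HeightOneSpectrum (𝓞 K)) {n : ℕ} (hn : ((n : ℕ) : 𝓞 K) ∈ w.asIdeal) :
    natGenerator (w.under (𝓞 ℚ)) ∣ n := by
  have h : ((n : ℕ) : 𝓞 ℚ) ∈ (w.under (𝓞 ℚ)).asIdeal := by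
    change algebraMap (𝓞 ℚ) (𝓞 K) ((n : ℕ) : 𝓞 ℚ) ∈ w.asIdeal
    rwa [map_natCast]
  exact (Literature.NumberTheory.GaloisRepresentations.Rat.natCast_mem_asIdeal_iff _).mp h

/-- `hvS₀`: `vp = (p)` does not lie above the finite set `S₀` of rational places away from `p` (two distinct rational primes are coprime in `𝓞 K`).
[cite: NeukirchANT1999, Ch. I §8 (8.2)–(8.3)] -/
theorem not_mem_placesAboveFinset_of_eq_span (S₀ : Finset (HeightOneSpectrum (𝓞 ℚ))) (hS₀p : ∀ v ∈ S₀, ((p : ℕ) : 𝓞 ℚ) ∉ v.asIdeal)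
    {vp : HeightOneSpectrum (𝓞 K)} (hv : vp.asIdeal = Ideal.span {((p : ℕ) : 𝓞 K)}) :
    vp ∉ {w : HeightOneSpectrum (𝓞 K) | ∃ v ∈ S₀, ((natGenerator v : ℕ) : 𝓞 K) ∈ w.asIdeal} := by
  rintro ⟨v, hvS, hvw⟩
  have hpv : ((p : ℕ) : 𝓞 K) ∈ vp.asIdeal := natCast_mem_asIdeal_of_eq_span hv
  by_cases hℓ : natGenerator v = p
  · exact hS₀p v hvS (hℓ ▸ (Literature.NumberTheory.GaloisRepresentations.Rat.natCast_mem_asIdeal_iff v).mpr dvd_rfl)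
  · have hcop : IsCoprime ((natGenerator v : ℕ) : 𝓞 K) ((p : ℕ) : 𝓞 K) :=
      Nat.Coprime.cast ((Nat.coprime_primes (prime_natGenerator v) Fact.out).mpr hℓ)
    obtain ⟨a, b, hab⟩ := hcop
    have h1 : (1 : 𝓞 K) ∈ vp.asIdeal := by
      rw [← hab]
      exact vp.asIdeal.add_mem (vp.asIdeal.mul_mem_left a hvw) (vp.asIdeal.mul_mem_left b hpv)
    exact vp.isPrime.ne_top ((Ideal.eq_top_iff_one _).mpr h1)

/-- `hS₀`: the set of places of `K` above a finite set `S₀` of rational places is finite (each `ℓ_v 𝓞_K ≠ 0` has finitely many prime factors).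
[cite: NeukirchANT1999, Ch. I §8 (8.2)–(8.3)] -/
theorem finite_placesAboveFinset (S₀ : Finset (HeightOneSpectrum (𝓞 ℚ))) :
    {w : HeightOneSpectrum (𝓞 K) | ∃ v ∈ S₀, ((natGenerator v : ℕ) : 𝓞 K) ∈ w.asIdeal}.Finite := by
  have hfin : ∀ v : HeightOneSpectrum (𝓞 ℚ), {w : HeightOneSpectrum (𝓞 K) | ((natGenerator v : ℕ) : 𝓞 K) ∈ w.asIdeal}.Finite := by
    intro v
    have hne : Ideal.span {((natGenerator v : ℕ) : 𝓞 K)} ≠ 0 := by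
      rw [Ne, Ideal.zero_eq_bot, Ideal.span_singleton_eq_bot]
      exact_mod_cast (prime_natGenerator v).ne_zero
    exact (Ideal.finite_factors hne).subset fun w hw ↦ Ideal.dvd_span_singleton.mpr hw
  refine ((S₀ : Set (HeightOneSpectrum (𝓞 ℚ))).toFinite.biUnion fun v _ ↦ hfin v).subset ?_
  rintro w ⟨v, hv, hw⟩
  exact Set.mem_biUnion (Finset.mem_coe.mpr hv) hw

/-- `hP`: `supp(p𝔣)` is finite for `𝔣 ≠ 0`. [cite: JohnsonLeungKings2011, §4.1] -/
theorem finite_suppPF_of_ne_bot {𝔣 : Ideal (𝓞 K)} (h𝔣 : 𝔣 ≠ ⊥) : (suppPF p 𝔣).Finite :=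
  ClassGroupRow.finite_suppPF p 𝔣 h𝔣

/-- `hNP`: the ramification subgroup `N_{supp(p𝔣)}` lies in every layer subgroup `U_n` of a `ℤ_p`-extension (these are unramified outside `p`).
[cite: Washington1997, Prop. 13.2] [cite: NeukirchSchmidtWingberg2008, VIII §3] -/
theorem ramificationSubgroup_suppPF_le_layerSubgroup (κ : ZpExtension K p) (𝔣 : Ideal (𝓞 K)) :
    ∀ n : ℕ, ramificationSubgroup K (suppPF p 𝔣) ≤ κ.layerSubgroup n :=
  fun n _ hσ ↦ κ.kerSubgroup_le_layerSubgroup n (Subgroup.mem_inf.mp (PrintCf2.JLKDescent.ramificationSubgroup_suppPF_le_pairKer κ κ 𝔣 hσ)).1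

/-- `hγB`: for NORMALISED topological generators `γK` of `κ` and `γv` of the local tower (`κ(γK) = κ(res γv) = 1 ∈ ℤ_p`), `γK⁻¹ · res γv ∈ ker κ`.
[cite: Washington1997, §13.1–13.2] -/
theorem inv_mul_resGalOfEmb_mem_kerSubgroup {κ : ZpExtension K p} {γK : absoluteGaloisGroup K} (hγK : κ.IsTopGenerator γK)
    {v : HeightOneSpectrum (𝓞 K)} {γv : absoluteGaloisGroup (v.adicCompletion K)}
    (hγv : κ.IsTopGenerator (resGalOfEmb (closureEmb (K := K) (v.adicCompletion K)) γv)) :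
    γK⁻¹ * resGalOfEmb (closureEmb (K := K) (v.adicCompletion K)) γv ∈ κ.kerSubgroup := by
  rw [ZpExtension.mem_kerSubgroup, map_mul, map_inv]
  unfold ZpExtension.IsTopGenerator at hγK hγv
  rw [hγK, hγv, inv_mul_cancel]

variable (S : Set (PadicAlgCl p)) {d : ℕ} (θ : FramedGaloisRep K (padicCoeffIntegers S) d) {θ' : absoluteGaloisGroup K →ₜ* (padicCoeffIntegers S)ˣ}
  {𝔣 : Ideal (𝓞 K)}

omit [NumberField K] in
/-- `hθN`: under (U) («`θ′` unramified off `supp(p𝔣)`»), `θ′` is trivial on `N_{supp(p𝔣)}` (LEAD p792933 `eq_one_of_mem_ramificationSubgroup`).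
[cite: NeukirchSchmidtWingberg2008, VIII §3] -/
theorem frame_eq_one_of_mem_ramificationSubgroup
    (hU : ∀ w : HeightOneSpectrum (𝓞 K), w ∉ suppPF p 𝔣 → ∀ 𝔓 ∈ w.primesAbove, ∀ τ ∈ 𝔓.inertia (absoluteGaloisGroup K), θ' τ = 1) :
    ∀ g ∈ ramificationSubgroup K (suppPF p 𝔣), θ' g = 1 :=
  fun _ hg ↦ SmallImageRttD2Twist.eq_one_of_mem_ramificationSubgroup (suppPF p 𝔣) θ' hU hg

omit [NumberField K] in
/-- From `θ′(τ)·θ(τ)₀₀ = 1` and `θ′(τ) = 1`: the rank-one `θ(τ) = 1` in `GL₁(𝒪)`. [cite: SerreAbelianLadic1968, I §2.1] -/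
theorem frame_apply_eq_one_of_eq_one (θ : FramedGaloisRep K (padicCoeffIntegers S) 1)
    (hθ'θ : ∀ g : absoluteGaloisGroup K, ((θ' g : (padicCoeffIntegers S)ˣ) : padicCoeffIntegers S) *
      ((θ g : GL (Fin 1) (padicCoeffIntegers S)) : Matrix (Fin 1) (Fin 1) (padicCoeffIntegers S)) 0 0 = 1)
    {τ : absoluteGaloisGroup K} (hτ : θ' τ = 1) : θ τ = 1 := by
  have h00 : ((θ τ : GL (Fin 1) (padicCoeffIntegers S)) : Matrix (Fin 1) (Fin 1) (padicCoeffIntegers S)) 0 0 = 1 := by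
    have h := hθ'θ τ
    rwa [hτ, Units.val_one, one_mul] at h
  refine Units.ext (Matrix.ext fun i j ↦ ?_)
  fin_cases i; fin_cases j
  simpa using h00

omit [NumberField K] in
/-- From `θ′(τ)·θ(τ)₀₀ = 1` and `θ(τ) = 1`: `θ′(τ) = 1`. [cite: SerreAbelianLadic1968, I §2.1] -/
theorem frame_eq_one_of_apply_eq_one (θ : FramedGaloisRep K (padicCoeffIntegers S) 1)
    (hθ'θ : ∀ g : absoluteGaloisGroup K, ((θ' g : (padicCoeffIntegers S)ˣ) : padicCoeffIntegers S) *
      ((θ g : GL (Fin 1) (padicCoeffIntegers S)) : Matrix (Fin 1) (Fin 1) (padicCoeffIntegers S)) 0 0 = 1)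
    {τ : absoluteGaloisGroup K} (hτ : θ τ = 1) : θ' τ = 1 := by
  have h := hθ'θ τ
  rw [hτ, Units.val_one, Matrix.one_apply_eq, mul_one] at h
  exact Units.val_eq_one.mp h

omit [NumberField K] in
/-- `hunrP`: under (U) and `θ′·θ₀₀ = 1`, the rank-one `θ` is unramified off `supp(p𝔣)`. [cite: SerreAbelianLadic1968, I §2.1] [cite: NeukirchSchmidtWingberg2008, VIII §3] -/
theorem isUnramifiedAt_of_frameSupp (θ : FramedGaloisRep K (padicCoeffIntegers S) 1)
    (hθ'θ : ∀ g : absoluteGaloisGroup K, ((θ' g : (padicCoeffIntegers S)ˣ) : padicCoeffIntegers S) *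
      ((θ g : GL (Fin 1) (padicCoeffIntegers S)) : Matrix (Fin 1) (Fin 1) (padicCoeffIntegers S)) 0 0 = 1)
    (hU : ∀ w : HeightOneSpectrum (𝓞 K), w ∉ suppPF p 𝔣 → ∀ 𝔓 ∈ w.primesAbove, ∀ τ ∈ 𝔓.inertia (absoluteGaloisGroup K), θ' τ = 1) :
    ∀ w : HeightOneSpectrum (𝓞 K), w ∉ suppPF p 𝔣 → FramedGaloisRep.IsUnramifiedAt w θ :=
  fun w hw 𝔓 h𝔓 τ hτ ↦ frame_apply_eq_one_of_eq_one S θ hθ'θ (hU w hw 𝔓 h𝔓 τ hτ)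

omit [NumberField K] in
/-- `hMP`: under (U) and `θ′·θ₀₀ = 1`, inertia off `supp(p𝔣)` acts trivially on `M = Cofree θ F` (R8 `forall_smul_cofree_eq_of_isUnramifiedOutside`).
[cite: SerreAbelianLadic1968, I §2.1] [cite: GreenbergVatsal2000, §2 pp. 16–17] -/
theorem forall_smul_cofree_eq_of_frameSupp (θ : FramedGaloisRep K (padicCoeffIntegers S) 1)
    (hθ'θ : ∀ g : absoluteGaloisGroup K, ((θ' g : (padicCoeffIntegers S)ˣ) : padicCoeffIntegers S) *
      ((θ g : GL (Fin 1) (padicCoeffIntegers S)) : Matrix (Fin 1) (Fin 1) (padicCoeffIntegers S)) 0 0 = 1)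
    (hU : ∀ w : HeightOneSpectrum (𝓞 K), w ∉ suppPF p 𝔣 → ∀ 𝔓 ∈ w.primesAbove, ∀ τ ∈ 𝔓.inertia (absoluteGaloisGroup K), θ' τ = 1) :
    ∀ w : HeightOneSpectrum (𝓞 K), w ∉ suppPF p 𝔣 → ∀ 𝔓 ∈ w.primesAbove, ∀ τ ∈ 𝔓.inertia (absoluteGaloisGroup K),
      ∀ m : Cofree θ (padicCoeffField S), τ • m = m :=
  forall_smul_cofree_eq_of_isUnramifiedOutside S θ (isUnramifiedAt_of_frameSupp S θ hθ'θ hU)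

/-- `hPS₀`: EVERY place of `supp(p𝔣)` not above `S₀` is `vp = (p)`. For `w ∣ 𝔣`, `w ∤ p`: by (R) some inertia element above `w` is not killed by `θ′`, so `θ` is ramified at
`w` (`θ′·θ₀₀ = 1`), so `𝔪 ≤ w` (`hθ`: `θ` is unramified off `p𝔪`), so the rational prime `ℓ` below `w` divides `N𝔪`, so `W` has bad reduction at `ℓ` (`hbad`), so the place
`(ℓ)` lies in `S₀` (`hS₀bad`) and `w` lies above `S₀`. [cite: SilvermanAEC2009, VII.5 Prop. 5.1] [cite: SerreAbelianLadic1968, I §2.1] [cite: NeukirchANT1999, Ch. I §8] -/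
theorem eq_of_mem_suppPF_of_not_mem_placesAboveFinset (θ : FramedGaloisRep K (padicCoeffIntegers S) 1) (W : WeierstrassCurve ℚ)
    (S₀ : Finset (HeightOneSpectrum (𝓞 ℚ))) (hS₀bad : ∀ v : HeightOneSpectrum (𝓞 ℚ), ¬ W.HasGoodReductionAt v → v ∈ S₀) {𝔪 : Ideal (𝓞 K)}
    (hbad : ∀ (ℓ : ℕ) [Fact ℓ.Prime], ℓ ∣ (NumberField.discr K).natAbs * Ideal.absNorm 𝔪 → ¬ W.HasGoodReductionAtPrime ℓ)
    (hθunr : ∀ w : HeightOneSpectrum (𝓞 K), (p : 𝓞 K) ∉ w.asIdeal → ¬ 𝔪 ≤ w.asIdeal → FramedGaloisRep.IsUnramifiedAt w θ)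
    {vp : HeightOneSpectrum (𝓞 K)} (hv : vp.asIdeal = Ideal.span {((p : ℕ) : 𝓞 K)})
    (hθ'θ : ∀ g : absoluteGaloisGroup K, ((θ' g : (padicCoeffIntegers S)ˣ) : padicCoeffIntegers S) *
      ((θ g : GL (Fin 1) (padicCoeffIntegers S)) : Matrix (Fin 1) (Fin 1) (padicCoeffIntegers S)) 0 0 = 1)
    (hR : ∀ w ∈ suppPF p 𝔣, ((p : ℕ) : 𝓞 K) ∉ w.asIdeal → ∃ 𝔓 ∈ w.primesAbove, ∃ τ ∈ 𝔓.inertia (absoluteGaloisGroup K), θ' τ ≠ 1) :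
    ∀ w ∈ suppPF p 𝔣, w ∉ {w : HeightOneSpectrum (𝓞 K) | ∃ v ∈ S₀, ((natGenerator v : ℕ) : 𝓞 K) ∈ w.asIdeal} → w = vp := by
  intro w hw hwS
  by_cases hpw : ((p : ℕ) : 𝓞 K) ∈ w.asIdeal
  · exact eq_of_natCast_mem_asIdeal_of_eq_span hv w hpw
  exfalso
  obtain ⟨𝔓, h𝔓, τ, hτ, hne⟩ := hR w hw hpw
  -- `θ` is ramified at `w`, hence `𝔪 ≤ w`
  have h𝔪w : 𝔪 ≤ w.asIdeal := by
    by_contra h𝔪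
    exact hne (frame_eq_one_of_apply_eq_one S θ hθ'θ (hθunr w hpw h𝔪 𝔓 h𝔓 τ hτ))
  -- the rational place `v` below `w`, `ℓ_v ∣ N𝔪`
  set v : HeightOneSpectrum (𝓞 ℚ) := w.under (𝓞 ℚ) with hvdef
  have hℓ𝔪 : natGenerator v ∣ Ideal.absNorm 𝔪 :=
    natGenerator_under_dvd_of_natCast_mem w (h𝔪w (Ideal.absNorm_mem 𝔪))
  -- bad reduction at `ℓ_v`, so `v ∈ S₀` and `w` lies above `S₀`
  haveI := Fact.mk (primesEquiv v).2
  have hgood : ¬ W.HasGoodReductionAt v := fun hgood ↦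
    hbad (primesEquiv v : ℕ) (dvd_mul_of_dvd_right hℓ𝔪 _) ((W.hasGoodReductionAtPrime_iff_hasGoodReductionAt_ringOfIntegers v).2 hgood)
  have hℓw : ((natGenerator v : ℕ) : 𝓞 K) ∈ w.asIdeal := by
    have h : ((natGenerator v : ℕ) : 𝓞 ℚ) ∈ v.asIdeal :=
      (Literature.NumberTheory.GaloisRepresentations.Rat.natCast_mem_asIdeal_iff _).mpr dvd_rfl
    have h' : algebraMap (𝓞 ℚ) (𝓞 K) ((natGenerator v : ℕ) : 𝓞 ℚ) ∈ w.asIdeal := h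
    rwa [map_natCast] at h'
  exact hwS ⟨v, hS₀bad v hgood, hℓw⟩

/-- A perfect `λ` is non-zero: `λ = 0` would put `1 ∈ (p)` in `𝒪 = padicCoeffIntegers S`, but `p` is not a unit there. [cite: SerreLocalFields1979, Ch. III §3] -/
theorem lam_ne_zero_of_lamInj {lam : padicCoeffIntegers S →+ ℤ_[p]}
    (hlamInj : ∀ (m : ℕ) (t : padicCoeffIntegers S), (∀ b : padicCoeffIntegers S, lamZMod S lam m (b * t) = 0) →
      t ∈ Ideal.span {((p : ℕ) : padicCoeffIntegers S) ^ m}) : lam ≠ 0 := by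
  intro hlam
  have h1 : (1 : padicCoeffIntegers S) ∈ Ideal.span {((p : ℕ) : padicCoeffIntegers S) ^ 1} :=
    hlamInj 1 1 fun b ↦ by rw [lamZMod_apply, hlam, AddMonoidHom.zero_apply, map_zero]
  rw [pow_one, Ideal.mem_span_singleton] at h1
  have hunit : IsUnit ((p : ℕ) : padicCoeffIntegers S) := isUnit_of_dvd_one h1
  rw [padicCoeffIntegers_eq_unitBall S] at hunit
  exact Literature.NumberTheory.Automorphic.PadicIntermediateField.not_isUnit_natCast_prime p _ hunit

end Plumbing

/-! ## §2. S2 frame-plumbed -/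

section S2

set_option maxHeartbeats 800000 in
/-- ★★★ **S2 (v23 SPEC item 5) ON THE SKELETON'S Γ-BINDERS.** For the cyclotomic `κ` of `ℚ` restricted to the quadratic `K` (`p ≠ 2` inert, `p ∤ d_K`, `K` totally complex), the
place `vp = (p)`, the frame `(θ′, 𝔣)` with `θ′·θ₀₀ = 1` and the support conditions (R)/(U), and the curve/character clauses `hθ` (unramified off `p𝔪`), `hbad`, `hS₀bad`, `hS₀p`:
there is a `ℤ_p`-linear `λ : 𝒪 → ℤ_p`, `λ ≠ 0`, such that for every inert-place datum `(γv, DQ, instX, instQ, hιX, hιQ, hCX, hCQ)` EVERY junction map `jv : I.H →ₗ[Λ_𝒪] DQ.X` pinned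
by -w3's tower pairing (`DQ.toDual (jv b) = (𝓛.towerPairing I).pairing _ b`, `𝓛 = layerPairingOf … (cofreeLamCoeffPairing S λ …) … γK⁻¹ γv …`) is EXACT with `gX` on the
definite strict carrier `B′ = strictCarrier I (strictLevel S κ_K θ′ (supp p𝔣) S₀K)` (= the line file's `JunctionCarrier`). All of H7h's frame hypotheses are discharged by §1.
[cite: Kobayashi2003, Thm. 7.3 i)] [cite: Rubin2000, Thm. 1.7.3, §4.2] [cite: NeukirchSchmidtWingberg2008, VIII §6, (7.2.6)] [cite: Kato2004Asterisque, §17.13] [cite: Washington1997, Prop. 13.2] -/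
theorem exists_lam_forall_exact_junctionMap_comp_subtype_cofree_frame
    {p : ℕ} [Fact p.Prime] (hp : p ≠ 2) {κ : ZpExtension ℚ p} (hκ : κ.IsCyclotomic)
    {K : Type} [Field K] [NumberField K] (hK2 : Module.finrank ℚ K = 2) (htc : IsTotallyComplex K) (hnd : ¬ (p : ℤ) ∣ NumberField.discr K)
    (S : Set (PadicAlgCl p)) (hS : 0 < Module.finrank ℚ_[p] (padicCoeffField S)) (θ : FramedGaloisRep K (padicCoeffIntegers S) 1) (W : WeierstrassCurve ℚ)
    (j : (W.baseChange K).geomPrimaryTorsion p →+ Cofree θ (padicCoeffField S)) (ε : ℤˣ)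
    {γK : absoluteGaloisGroup K} (hγK : (κ.restrictOfFinrankEqTwo hp K hK2).IsTopGenerator γK)
    (S₀ : Finset (HeightOneSpectrum (𝓞 ℚ))) (hS₀p : ∀ v ∈ S₀, ((p : ℕ) : 𝓞 ℚ) ∉ v.asIdeal)
    (hS₀bad : ∀ v : HeightOneSpectrum (𝓞 ℚ), ¬ W.HasGoodReductionAt v → v ∈ S₀) {𝔪 : Ideal (𝓞 K)}
    (hbad : ∀ (ℓ : ℕ) [Fact ℓ.Prime], ℓ ∣ (NumberField.discr K).natAbs * Ideal.absNorm 𝔪 → ¬ W.HasGoodReductionAtPrime ℓ)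
    (hθunr : ∀ w : HeightOneSpectrum (𝓞 K), (p : 𝓞 K) ∉ w.asIdeal → ¬ 𝔪 ≤ w.asIdeal → FramedGaloisRep.IsUnramifiedAt w θ)
    (D : SignedTransportDualDataSat (κ.restrictOfFinrankEqTwo hp K hK2) γK (Cofree θ (padicCoeffField S)) (padicCoeffIntegers S) (W.baseChange K) j
      {w : HeightOneSpectrum (𝓞 K) | ∃ v ∈ S₀, ((natGenerator v : ℕ) : 𝓞 K) ∈ w.asIdeal} ε)
    (vp : HeightOneSpectrum (𝓞 K)) (hv : vp.asIdeal = Ideal.span {((p : ℕ) : 𝓞 K)})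
    {θ' : absoluteGaloisGroup K →ₜ* (padicCoeffIntegers S)ˣ} {𝔣 : Ideal (𝓞 K)} (h𝔣 : 𝔣 ≠ ⊥)
    (hθ'θ : ∀ g : absoluteGaloisGroup K, ((θ' g : (padicCoeffIntegers S)ˣ) : padicCoeffIntegers S) *
      ((θ g : GL (Fin 1) (padicCoeffIntegers S)) : Matrix (Fin 1) (Fin 1) (padicCoeffIntegers S)) 0 0 = 1)
    (hR : ∀ w ∈ suppPF p 𝔣, ((p : ℕ) : 𝓞 K) ∉ w.asIdeal → ∃ 𝔓 ∈ w.primesAbove, ∃ τ ∈ 𝔓.inertia (absoluteGaloisGroup K), θ' τ ≠ 1)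
    (hU : ∀ w : HeightOneSpectrum (𝓞 K), w ∉ suppPF p 𝔣 → ∀ 𝔓 ∈ w.primesAbove, ∀ τ ∈ 𝔓.inertia (absoluteGaloisGroup K), θ' τ = 1)
    (I : CycIwasawaCohomologyDataO S (κ.restrictOfFinrankEqTwo hp K hK2) γK⁻¹ θ' (suppPF p 𝔣) 1) :
    letI := localAction (closureEmb (K := K) (vp.adicCompletion K)) (Cofree θ (padicCoeffField S))
    haveI := smulCommClass_localAction (R := padicCoeffIntegers S) (Cofree θ (padicCoeffField S)) vp
    haveI : FiniteDimensional ℚ_[p] (padicCoeffField S) := Module.finite_of_finrank_pos hS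
    ∃ (lam : padicCoeffIntegers S →+ ℤ_[p]) (hlam : ∀ (c : ℤ_[p]) (y : padicCoeffIntegers S), lam (padicIntToCoeffIntegers S c * y) = c * lam y),
      lam ≠ 0 ∧
      ∀ (γv : absoluteGaloisGroup (vp.adicCompletion K))
        (hγv : (κ.restrictOfFinrankEqTwo hp K hK2).IsTopGenerator (resGalOfEmb (closureEmb (K := K) (vp.adicCompletion K)) γv))
        (DQ : LocalCondDualData (κ.restrictOfFinrankEqTwo hp K hK2) (Cofree θ (padicCoeffField S)) (padicCoeffIntegers S) (W.baseChange K) j ε vp γv)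
        (instX : Module (IwasawaAlgebraO S) D.X) (instQ : Module (IwasawaAlgebraO S) DQ.X)
        (hιX : ∀ (f : IwasawaAlgebra p) (x : D.X), (letI := instX; iwasawaToIwasawaO S f • x) = f • x)
        (hιQ : ∀ (f : IwasawaAlgebra p) (x : DQ.X), (letI := instQ; iwasawaToIwasawaO S f • x) = f • x)
        (hCX : ∀ (a₁ : padicCoeffIntegers S) (x : D.X)
            (s₁ : signedTransportSelmerInftySat (κ.restrictOfFinrankEqTwo hp K hK2) (Cofree θ (padicCoeffField S)) (padicCoeffIntegers S) (W.baseChange K) j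
              {w : HeightOneSpectrum (𝓞 K) | ∃ v ∈ S₀, ((natGenerator v : ℕ) : 𝓞 K) ∈ w.asIdeal} ε),
          D.toDual (letI := instX; (PowerSeries.C a₁ : IwasawaAlgebraO S) • x) s₁ =
            D.toDual x ⟨GreenbergSelmer.scalarH1 _ _ a₁ s₁,
              scalarH1_mem_signedTransportSelmerInftySat _ _ (padicCoeffIntegers S) (W.baseChange K) j
                {w : HeightOneSpectrum (𝓞 K) | ∃ v ∈ S₀, ((natGenerator v : ℕ) : 𝓞 K) ∈ w.asIdeal} ε a₁ s₁.2⟩)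
        (hCQ : ∀ (a₁ : padicCoeffIntegers S) (x : DQ.X)
            (c : localCondInftySat (κ.restrictOfFinrankEqTwo hp K hK2) (Cofree θ (padicCoeffField S)) (padicCoeffIntegers S) (W.baseChange K) j ε vp),
          DQ.toDual (letI := instQ; (PowerSeries.C a₁ : IwasawaAlgebraO S) • x) c =
            DQ.toDual x (scalarLocalSat _ _ (padicCoeffIntegers S) (W.baseChange K) j ε vp a₁ c)),
        letI := instX; letI := instQ
        ∀ jv : I.H →ₗ[IwasawaAlgebraO S] DQ.X,
          (∀ b : I.H, DQ.toDual (jv b) =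
            ((layerPairingOf S (κ.restrictOfFinrankEqTwo hp K hK2) θ' (suppPF p 𝔣) vp (Cofree θ (padicCoeffField S))
              (isOpen_stabilizer_of_hres (Cofree θ (padicCoeffField S)) vp (fun _ _ ↦ rfl) (GreenbergSelmer.isOpen_stabilizer_cofree S θ))
              (cofreeLamCoeffPairing S lam hlam θ' (suppPF p 𝔣) vp θ (fun _ _ ↦ rfl)
                (isOpen_stabilizer_of_hres (Cofree θ (padicCoeffField S)) vp (fun _ _ ↦ rfl) (GreenbergSelmer.isOpen_stabilizer_cofree S θ)) hθ'θ)
              (GreenbergSelmer.exists_pow_smul_cofree_eq_zero S θ) γK⁻¹ γv (inv_mul_resGalOfEmb_mem_kerSubgroup hγK hγv)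
              (ramificationSubgroup_suppPF_le_layerSubgroup (κ.restrictOfFinrankEqTwo hp K hK2) 𝔣)
              (isNonsplitIn_restrictOfFinrankEqTwo hp hκ K hK2 hnd (natCast_mem_asIdeal_of_eq_span hv))
              (cofreeLamCoeffPairing_hPred S lam hlam θ' (suppPF p 𝔣) vp θ (fun _ _ ↦ rfl)
                (isOpen_stabilizer_of_hres (Cofree θ (padicCoeffField S)) vp (fun _ _ ↦ rfl) (GreenbergSelmer.isOpen_stabilizer_cofree S θ)) hθ'θ)
              (cofreeLamCoeffPairing_hPsc S lam hlam θ' (suppPF p 𝔣) vp θ (fun _ _ ↦ rfl)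
                (isOpen_stabilizer_of_hres (Cofree θ (padicCoeffField S)) vp (fun _ _ ↦ rfl) (GreenbergSelmer.isOpen_stabilizer_cofree S θ)) hθ'θ)).towerPairing I).pairing
              (isOpen_stabilizer_of_hres (Cofree θ (padicCoeffField S)) vp (fun _ _ ↦ rfl) (GreenbergSelmer.isOpen_stabilizer_cofree S θ)) b) →
          Function.Exact
            (jv ∘ₗ (strictCarrier I (strictLevel S (κ.restrictOfFinrankEqTwo hp K hK2) θ' (suppPF p 𝔣)
                {w : HeightOneSpectrum (𝓞 K) | ∃ v ∈ S₀, ((natGenerator v : ℕ) : 𝓞 K) ∈ w.asIdeal})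
              (fun n k f _ hy ↦ smul_mem_strictLevel S (κ.restrictOfFinrankEqTwo hp K hK2) θ' (suppPF p 𝔣)
                {w : HeightOneSpectrum (𝓞 K) | ∃ v ∈ S₀, ((natGenerator v : ℕ) : 𝓞 K) ∈ w.asIdeal} γK⁻¹ n k f hy)).subtype)
            (gXLinearMapO S D DQ (fun _ _ ↦ rfl) (natCast_mem_asIdeal_of_eq_span hv) instX instQ hιX hιQ hCX hCQ
              (GreenbergSelmer.exists_pow_smul_cofree_eq_zero S θ) (GreenbergSelmer.isOpen_stabilizer_cofree S θ)
              (isOpen_stabilizer_of_hres (Cofree θ (padicCoeffField S)) vp (fun _ _ ↦ rfl) (GreenbergSelmer.isOpen_stabilizer_cofree S θ)) hγK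
              (isNonsplitIn_restrictOfFinrankEqTwo hp hκ K hK2 hnd (natCast_mem_asIdeal_of_eq_span hv)) hγv) := by
  letI := localAction (closureEmb (K := K) (vp.adicCompletion K)) (Cofree θ (padicCoeffField S))
  haveI := smulCommClass_localAction (R := padicCoeffIntegers S) (Cofree θ (padicCoeffField S)) vp
  haveI : FiniteDimensional ℚ_[p] (padicCoeffField S) := Module.finite_of_finrank_pos hS
  haveI := htc
  obtain ⟨lam, hlam, hinj, hsurj⟩ := exists_lam_perfect S
  refine ⟨lam, hlam, lam_ne_zero_of_lamInj S hinj, ?_⟩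
  intro γv hγv DQ instX instQ hιX hιQ hCX hCQ jv hjv
  exact exact_junctionMap_comp_subtype_cofree_lam_of_lamPerfect S lam hlam θ D DQ (fun _ _ ↦ rfl) (natCast_mem_asIdeal_of_eq_span hv) I
    (isOpen_stabilizer_of_hres (Cofree θ (padicCoeffField S)) vp (fun _ _ ↦ rfl) (GreenbergSelmer.isOpen_stabilizer_cofree S θ)) hθ'θ
    (GreenbergSelmer.exists_pow_smul_cofree_eq_zero S θ) (inv_mul_resGalOfEmb_mem_kerSubgroup hγK hγv)
    (ramificationSubgroup_suppPF_le_layerSubgroup (κ.restrictOfFinrankEqTwo hp K hK2) 𝔣)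
    (isNonsplitIn_restrictOfFinrankEqTwo hp hκ K hK2 hnd (natCast_mem_asIdeal_of_eq_span hv)) rfl instX instQ hιX hιQ hCX hCQ
    (GreenbergSelmer.isOpen_stabilizer_cofree S θ) hγK hγv (finite_suppPF_of_ne_bot h𝔣) (finite_placesAboveFinset S₀)
    (eq_of_mem_suppPF_of_not_mem_placesAboveFinset S θ W S₀ hS₀bad hbad hθunr hv hθ'θ hR) (eq_of_natCast_mem_asIdeal_of_eq_span hv)
    (forall_smul_cofree_eq_of_frameSupp S θ hθ'θ hU) (not_mem_placesAboveFinset_of_eq_span S₀ hS₀p hv) (mem_suppPF_of_eq_span 𝔣 hv)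
    (frame_eq_one_of_mem_ramificationSubgroup S hU) hinj hsurj jv hjv

end S2

end Summit.BirchSwinnertonDyer.BirchSwinnertonDyer.Theorems.SmallImageRttD2Seq

end
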